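import Summits.CriticalPhenomena.PercolationContinuityZ3.Theorems.PercNearOneGluingNoHeavyLowerTailKnQuestion8CoefficientwiseNoCoreSeries
import HarnessLib

/-!
# NO-CORE with two-sided avoidance (`NCA`) is closed under gluing at a cut vertex — prim-lf-2 gen 63

Support file (`--supports stmt-CriticalPhenomena-4575`, closed), prover `prim-lf-2` (gen 63).  No definitions, no named facts, no sorries; standard axioms.
Memo `prim-lf-2/CW-NCA-gen63.md` §2 (THEOREM NCA-GLUE).  Templates: gen 55's `…CoefficientwiseNoCoreSeries.lean` (`noCore_series_core`) and
`…CoefficientwiseNoCoreDecoration.lean`, both of which are special cases of the present theorem.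

Setting.  A finite multigraph `ends : ι → Sym2 V`; a colouring of an edge set `E` is its red set `s ⊆ E` (blue set `E ∖ s`); `C_x(s) = openCluster (ends '' s) x` is the
red cluster of the root `x`, `C_x(E ∖ s)` the blue one; `T(X,Y) = (fX − fY)(gX − gY)` for monotone `f, g : Set V → ℝ`.  For vertex sets `X, W` the NCA sum is
  `NCA_E(x; X, W)[f,g] := Σ_{s ⊆ E : (∀ v ∈ X, v ∉ C_x s ∧ v ∉ C_x(E∖s)) ∧ (∀ w ∈ W, ¬(w ∈ C_x s ∧ w ∈ C_x(E∖s)))} T(C_x s, C_x(E∖s))`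
('no vertex of `X` in either cluster, no vertex of `W` in the core `C_x s ∩ C_x(E∖s)`').  `W = ∅`: the two-sided avoidance sums `(I1)_X` (with `X = {y}` the atom `A₀₀`
of CW-ATOM-gen60 §9); `X = ∅, W = {y}`: CONJECTURE NO-CORE (gen 46).  CONJECTURE NCA (prim-lf-2 gen 63): every NCA sum is `≥ 0` (exact census: all rooted graphs on
≤ 5 vertices × all `(X, W)`, 4 995 cases, 0 failures; all cycles `C_n` by an explicit injection).

* `Coefficientwise.nca_glue` — **THEOREM NCA-GLUE.**  Let `E₁, E₂` be disjoint edge sets whose edges can only share the vertex `u`, with the root `x` on an `E₂`-edge only if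
  `x = u`.  If every NCA sum of `(E₁, x)` and every NCA sum of `(E₂, u)` is `≥ 0` (all vertex sets, all monotone pairs), then every NCA sum of `(E₁ ∪ E₂, x)` is `≥ 0`.
  Hence CONJECTURE NCA (⊇ NO-CORE, `(I1)_X`, `A₀₀ ≥ 0`) for all finite multigraphs follows from the 2-connected case (induction over the block–cut tree).
Proof (memo §2).  Colourings of `E₁ ∪ E₂` are pairs `(s₁, s₂)`; the clusters glue as `K = K₁ ∪ [u∈K₁]K₂` (`mem_openCluster_union_glue`), so the NCA event reads
`P₁(s₁) ∧ (u∈K₁ → a) ∧ (u∈K̄₁ → b) ∧ (u∈K₁∩K̄₁ → z)` (`a, b`: no `X`-vertex in `K₂`, `K̄₂`; `z`: no `W`-vertex in `K₂ ∩ K̄₂`).  Pairing `s₂` with `E₂ ∖ s₂` and splitting by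
`(a, b, z)`, every class is a sum of NCA sums of `(E₁, x)` for glued monotone pairs `A ↦ f(A ∪ [u∈A]K₂)`, except the class `a ∧ b ∧ z` (= the NCA event of `(E₂, u)`),
where the decoration identity leaves a residual which, summed over the class, is an NCA sum of `(E₂, u)` for the shifted pairs `B ↦ f(K₁ ∪ [u∈K₁]B)`.
[cite: KozmaNitzan2024, Questions 8–9 (§5.5 p. 36) (context: the Question-8 pocket covariance programme)]
-/

namespace Summit.CriticalPhenomena.PercolationContinuityZ3.Theorems

open Finset Literature.Probability.Percolation

namespace Coefficientwise

variable {ι V : Type*} [DecidableEq ι]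

open Classical in
/-- **THEOREM NCA-GLUE (cut-vertex closure of NO-CORE-with-avoidance).**  Let `E₁, E₂ ⊆ ι` be disjoint edge sets of a finite multigraph `ends : ι → Sym2 V` such that an
`E₁`-edge and an `E₂`-edge can only share the vertex `u`, and such that the root `x` lies on an `E₂`-edge only if `x = u`.  If for all vertex sets `X', W'` and all monotone
`φ, ψ` the NCA sums of `(E₁, x)` and of `(E₂, u)` are nonnegative, then for all `X, W` and all monotone `f, g`
`0 ≤ Σ_{s ⊆ E₁∪E₂ : (∀ v∈X, v ∉ C_x s ∧ v ∉ C_x((E₁∪E₂)∖s)) ∧ (∀ w∈W, ¬(w ∈ C_x s ∧ w ∈ C_x((E₁∪E₂)∖s)))} (f(C_x s) − f(C_x((E₁∪E₂)∖s)))(g(C_x s) − g(C_x((E₁∪E₂)∖s)))`.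
[cite: KozmaNitzan2024, Questions 8–9 (§5.5 p. 36) (context)] -/
theorem nca_glue (ends : ι → Sym2 V) {E₁ E₂ : Finset ι} (hE : Disjoint E₁ E₂) {x u : V}
    (hsep : ∀ e ∈ E₁, ∀ e' ∈ E₂, ∀ w : V, w ∈ ends e → w ∈ ends e' → w = u)
    (hx : ∀ e ∈ E₂, x ∈ ends e → x = u)
    (h₁ : ∀ (X' W' : Set V) (φ ψ : Set V → ℝ), Monotone φ → Monotone ψ →
      0 ≤ ∑ s ∈ E₁.powerset.filter (fun s : Finset ι =>
            (∀ v ∈ X', v ∉ openCluster (ends '' (↑s : Set ι)) x ∧ v ∉ openCluster (ends '' (↑(E₁ \ s) : Set ι)) x) ∧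
            (∀ w ∈ W', ¬ (w ∈ openCluster (ends '' (↑s : Set ι)) x ∧ w ∈ openCluster (ends '' (↑(E₁ \ s) : Set ι)) x))),
        (φ (openCluster (ends '' (↑s : Set ι)) x) - φ (openCluster (ends '' (↑(E₁ \ s) : Set ι)) x)) *
          (ψ (openCluster (ends '' (↑s : Set ι)) x) - ψ (openCluster (ends '' (↑(E₁ \ s) : Set ι)) x)))
    (h₂ : ∀ (X' W' : Set V) (φ ψ : Set V → ℝ), Monotone φ → Monotone ψ →
      0 ≤ ∑ s ∈ E₂.powerset.filter (fun s : Finset ι =>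
            (∀ v ∈ X', v ∉ openCluster (ends '' (↑s : Set ι)) u ∧ v ∉ openCluster (ends '' (↑(E₂ \ s) : Set ι)) u) ∧
            (∀ w ∈ W', ¬ (w ∈ openCluster (ends '' (↑s : Set ι)) u ∧ w ∈ openCluster (ends '' (↑(E₂ \ s) : Set ι)) u))),
        (φ (openCluster (ends '' (↑s : Set ι)) u) - φ (openCluster (ends '' (↑(E₂ \ s) : Set ι)) u)) *
          (ψ (openCluster (ends '' (↑s : Set ι)) u) - ψ (openCluster (ends '' (↑(E₂ \ s) : Set ι)) u)))
    (X W : Set V) (f g : Set V → ℝ) (hf : Monotone f) (hg : Monotone g) :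
    0 ≤ ∑ s ∈ (E₁ ∪ E₂).powerset.filter (fun s : Finset ι =>
            (∀ v ∈ X, v ∉ openCluster (ends '' (↑s : Set ι)) x ∧ v ∉ openCluster (ends '' (↑((E₁ ∪ E₂) \ s) : Set ι)) x) ∧
            (∀ w ∈ W, ¬ (w ∈ openCluster (ends '' (↑s : Set ι)) x ∧ w ∈ openCluster (ends '' (↑((E₁ ∪ E₂) \ s) : Set ι)) x))),
      (f (openCluster (ends '' (↑s : Set ι)) x) - f (openCluster (ends '' (↑((E₁ ∪ E₂) \ s) : Set ι)) x)) *
        (g (openCluster (ends '' (↑s : Set ι)) x) - g (openCluster (ends '' (↑((E₁ ∪ E₂) \ s) : Set ι)) x)) := by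
  -- notation: red clusters of `x` and of `u`, the gluing operation at `u`
  set K : Finset ι → Set V := fun s => openCluster (ends '' (↑s : Set ι)) x with hK
  set Ku : Finset ι → Set V := fun s => openCluster (ends '' (↑s : Set ι)) u with hKu
  set gl : Set V → Set V → Set V := fun A B => A ∪ {w | u ∈ A ∧ w ∈ B} with hgl
  change 0 ≤ ∑ s ∈ (E₁ ∪ E₂).powerset.filter (fun s => (∀ v ∈ X, v ∉ K s ∧ v ∉ K ((E₁ ∪ E₂) \ s)) ∧
      (∀ w ∈ W, ¬ (w ∈ K s ∧ w ∈ K ((E₁ ∪ E₂) \ s)))), (f (K s) - f (K ((E₁ ∪ E₂) \ s))) * (g (K s) - g (K ((E₁ ∪ E₂) \ s)))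
  have h₁' : ∀ (X' W' : Set V) (φ ψ : Set V → ℝ), Monotone φ → Monotone ψ →
      0 ≤ ∑ s ∈ E₁.powerset.filter (fun s => (∀ v ∈ X', v ∉ K s ∧ v ∉ K (E₁ \ s)) ∧ (∀ w ∈ W', ¬ (w ∈ K s ∧ w ∈ K (E₁ \ s)))),
        (φ (K s) - φ (K (E₁ \ s))) * (ψ (K s) - ψ (K (E₁ \ s))) := h₁
  have h₂' : ∀ (X' W' : Set V) (φ ψ : Set V → ℝ), Monotone φ → Monotone ψ →
      0 ≤ ∑ s ∈ E₂.powerset.filter (fun s => (∀ v ∈ X', v ∉ Ku s ∧ v ∉ Ku (E₂ \ s)) ∧ (∀ w ∈ W', ¬ (w ∈ Ku s ∧ w ∈ Ku (E₂ \ s)))),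
        (φ (Ku s) - φ (Ku (E₂ \ s))) * (ψ (Ku s) - ψ (Ku (E₂ \ s))) := h₂
  have mem_gl : ∀ (A B : Set V) (w : V), w ∈ gl A B ↔ w ∈ A ∨ (u ∈ A ∧ w ∈ B) := fun A B w => by
    simp only [hgl, Set.mem_union, Set.mem_setOf_eq]
  have gl_of_not : ∀ A B : Set V, u ∉ A → gl A B = A := by
    intro A B hu; ext w; rw [mem_gl]; tauto
  have gl_mono_left : ∀ {A A' : Set V} (B : Set V), A ⊆ A' → gl A B ⊆ gl A' B := by
    intro A A' B h w hw
    rw [mem_gl] at hw ⊢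
    rcases hw with hw | ⟨hv, hw⟩
    · exact Or.inl (h hw)
    · exact Or.inr ⟨h hv, hw⟩
  have gl_mono_right : ∀ (A : Set V) {B B' : Set V}, B ⊆ B' → gl A B ⊆ gl A B' := by
    intro A B B' h w hw
    rw [mem_gl] at hw ⊢
    rcases hw with hw | ⟨hv, hw⟩
    · exact Or.inl hw
    · exact Or.inr ⟨hv, h hw⟩
  -- an `E₁`-cluster of `x` and an `E₂`-cluster of `u` meet only at `u`
  have meet : ∀ s₁ t₂ : Finset ι, s₁ ⊆ E₁ → t₂ ⊆ E₂ → ∀ w : V, w ∈ K s₁ → w ∈ Ku t₂ → w = u := by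
    intro s₁ t₂ hs₁ ht₂ w hw1 hw2
    by_contra hne
    obtain ⟨e', he', hwe'⟩ := exists_edge_of_mem_openCluster ends hw2 hne
    by_cases hwx : w = x
    · rw [hwx] at hwe' hne
      exact hne (hx e' (ht₂ he') hwe')
    · obtain ⟨e, he, hwe⟩ := exists_edge_of_mem_openCluster ends hw1 hwx
      exact hne (hsep e (hs₁ he) e' (ht₂ he') w hwe hwe')
  -- cluster decomposition under gluing at `u`
  have decomp : ∀ s₁ s₂ : Finset ι, s₁ ⊆ E₁ → s₂ ⊆ E₂ → K (s₁ ∪ s₂) = gl (K s₁) (Ku s₂) := by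
    intro s₁ s₂ hs₁ hs₂
    ext w
    rw [mem_gl]
    exact mem_openCluster_union_glue ends (fun e he e' he' w hw hw' => hsep e (hs₁ he) e' (hs₂ he') w hw hw')
      (fun e he hxe => hx e (hs₂ he) hxe) w
  -- the predicates: `P₁` = NCA event on `E₁`; `a t` = no vertex of `X` in the `E₂`-cluster `Ku t`; `z t` = no vertex of `W` in the `E₂`-core
  set P₁ : Finset ι → Prop := fun s => (∀ v ∈ X, v ∉ K s ∧ v ∉ K (E₁ \ s)) ∧ (∀ w ∈ W, ¬ (w ∈ K s ∧ w ∈ K (E₁ \ s))) with hP₁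
  set a : Finset ι → Prop := fun t => ∀ v ∈ X, v ∉ Ku t with ha
  set z : Finset ι → Prop := fun t => ∀ w ∈ W, ¬ (w ∈ Ku t ∧ w ∈ Ku (E₂ \ t)) with hz
  have hzc : ∀ s₂ : Finset ι, s₂ ⊆ E₂ → (z (E₂ \ s₂) ↔ z s₂) := by
    intro s₂ hs₂
    simp only [hz, Finset.sdiff_sdiff_eq_self hs₂]
    exact forall₂_congr fun w _ => by rw [and_comm]
  -- the NCA event of `E₁ ∪ E₂` in glued form
  have hcond : ∀ s₁ s₂ : Finset ι, s₁ ⊆ E₁ → s₂ ⊆ E₂ →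
      (((∀ v ∈ X, v ∉ gl (K s₁) (Ku s₂) ∧ v ∉ gl (K (E₁ \ s₁)) (Ku (E₂ \ s₂))) ∧
        (∀ w ∈ W, ¬ (w ∈ gl (K s₁) (Ku s₂) ∧ w ∈ gl (K (E₁ \ s₁)) (Ku (E₂ \ s₂))))) ↔
      (P₁ s₁ ∧ (u ∈ K s₁ → a s₂) ∧ (u ∈ K (E₁ \ s₁) → a (E₂ \ s₂)) ∧ (u ∈ K s₁ ∧ u ∈ K (E₁ \ s₁) → z s₂))) := by
    intro s₁ s₂ hs₁ hs₂
    constructor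
    · rintro ⟨hXg, hWg⟩
      refine ⟨⟨fun v hv => ?_, fun w hw hboth => ?_⟩, fun hu v hv hv2 => ?_, fun hu v hv hv2 => ?_, fun hu w hw hw2 => ?_⟩
      · obtain ⟨h1, h2⟩ := hXg v hv
        exact ⟨fun h => h1 ((mem_gl _ _ v).mpr (Or.inl h)), fun h => h2 ((mem_gl _ _ v).mpr (Or.inl h))⟩
      · exact hWg w hw ⟨(mem_gl _ _ w).mpr (Or.inl hboth.1), (mem_gl _ _ w).mpr (Or.inl hboth.2)⟩
      · exact (hXg v hv).1 ((mem_gl _ _ v).mpr (Or.inr ⟨hu, hv2⟩))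
      · exact (hXg v hv).2 ((mem_gl _ _ v).mpr (Or.inr ⟨hu, hv2⟩))
      · exact hWg w hw ⟨(mem_gl _ _ w).mpr (Or.inr ⟨hu.1, hw2.1⟩), (mem_gl _ _ w).mpr (Or.inr ⟨hu.2, hw2.2⟩)⟩
    · rintro ⟨hP, hA, hB, hZ⟩
      refine ⟨fun v hv => ⟨fun h => ?_, fun h => ?_⟩, fun w hw hboth => ?_⟩
      · rcases (mem_gl _ _ v).mp h with h | ⟨hu, h⟩
        · exact (hP.1 v hv).1 h
        · exact hA hu v hv h
      · rcases (mem_gl _ _ v).mp h with h | ⟨hu, h⟩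
        · exact (hP.1 v hv).2 h
        · exact hB hu v hv h
      · obtain ⟨hb1, hb2⟩ := hboth
        rcases (mem_gl _ _ w).mp hb1 with h1 | ⟨hu1, h1⟩ <;> rcases (mem_gl _ _ w).mp hb2 with h2 | ⟨hu2, h2⟩
        · exact hP.2 w hw ⟨h1, h2⟩
        · have hwu : w = u := meet s₁ (E₂ \ s₂) hs₁ Finset.sdiff_subset w h1 h2
          rw [hwu] at h1 hw
          exact hP.2 u hw ⟨h1, hu2⟩
        · have hwu : w = u := meet (E₁ \ s₁) s₂ Finset.sdiff_subset hs₂ w h2 h1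
          rw [hwu] at h2 hw
          exact hP.2 u hw ⟨hu1, h2⟩
        · exact hZ ⟨hu1, hu2⟩ w hw ⟨h1, h2⟩
  -- the sum over colourings of `E₁ ∪ E₂` as a double sum, each summand in glued form
  simp only [Finset.sum_filter]
  rw [DualBHK.sum_powerset_union hE, Finset.sum_comm]
  have hsummand : ∀ s₂ ∈ E₂.powerset, ∀ s₁ ∈ E₁.powerset,
      (if (∀ v ∈ X, v ∉ K (s₁ ∪ s₂) ∧ v ∉ K ((E₁ ∪ E₂) \ (s₁ ∪ s₂))) ∧ (∀ w ∈ W, ¬ (w ∈ K (s₁ ∪ s₂) ∧ w ∈ K ((E₁ ∪ E₂) \ (s₁ ∪ s₂))))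
        then (f (K (s₁ ∪ s₂)) - f (K ((E₁ ∪ E₂) \ (s₁ ∪ s₂)))) * (g (K (s₁ ∪ s₂)) - g (K ((E₁ ∪ E₂) \ (s₁ ∪ s₂)))) else 0)
      = (if P₁ s₁ ∧ (u ∈ K s₁ → a s₂) ∧ (u ∈ K (E₁ \ s₁) → a (E₂ \ s₂)) ∧ (u ∈ K s₁ ∧ u ∈ K (E₁ \ s₁) → z s₂)
        then (f (gl (K s₁) (Ku s₂)) - f (gl (K (E₁ \ s₁)) (Ku (E₂ \ s₂)))) *
          (g (gl (K s₁) (Ku s₂)) - g (gl (K (E₁ \ s₁)) (Ku (E₂ \ s₂)))) else 0) := by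
    intro s₂ hs₂ s₁ hs₁
    have hs₁' := Finset.mem_powerset.mp hs₁
    have hs₂' := Finset.mem_powerset.mp hs₂
    have hK12 : K (s₁ ∪ s₂) = gl (K s₁) (Ku s₂) := decomp s₁ s₂ hs₁' hs₂'
    have hKc : K ((E₁ ∪ E₂) \ (s₁ ∪ s₂)) = gl (K (E₁ \ s₁)) (Ku (E₂ \ s₂)) := by
      rw [union_sdiff_union_of_subset hE hs₁' hs₂']
      exact decomp (E₁ \ s₁) (E₂ \ s₂) Finset.sdiff_subset Finset.sdiff_subset
    rw [hK12, hKc]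
    exact if_congr (hcond s₁ s₂ hs₁' hs₂') rfl rfl
  rw [Finset.sum_congr rfl fun s₂ hs₂ => Finset.sum_congr rfl fun s₁ hs₁ => hsummand s₂ hs₂ s₁ hs₁]
  -- the inner sum `J s₂`
  set J : Finset ι → ℝ := fun s₂ => ∑ s₁ ∈ E₁.powerset,
      (if P₁ s₁ ∧ (u ∈ K s₁ → a s₂) ∧ (u ∈ K (E₁ \ s₁) → a (E₂ \ s₂)) ∧ (u ∈ K s₁ ∧ u ∈ K (E₁ \ s₁) → z s₂)
        then (f (gl (K s₁) (Ku s₂)) - f (gl (K (E₁ \ s₁)) (Ku (E₂ \ s₂)))) *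
          (g (gl (K s₁) (Ku s₂)) - g (gl (K (E₁ \ s₁)) (Ku (E₂ \ s₂)))) else 0) with hJ
  change 0 ≤ ∑ s₂ ∈ E₂.powerset, J s₂
  -- the three `E₁`-hypotheses in indicator form: events `P₁`, `P₁ ∧ u ∉ core`, `P₁ ∧ u ∉ K₁ ∪ K̄₁`
  have HXW : ∀ φ ψ : Set V → ℝ, Monotone φ → Monotone ψ →
      0 ≤ ∑ s₁ ∈ E₁.powerset, (if P₁ s₁ then (φ (K s₁) - φ (K (E₁ \ s₁))) * (ψ (K s₁) - ψ (K (E₁ \ s₁))) else 0) := by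
    intro φ ψ hφ hψ
    have := h₁' X W φ ψ hφ hψ
    rw [Finset.sum_filter] at this
    exact this
  have HXuW : ∀ φ ψ : Set V → ℝ, Monotone φ → Monotone ψ →
      0 ≤ ∑ s₁ ∈ E₁.powerset, (if P₁ s₁ ∧ ¬ (u ∈ K s₁ ∧ u ∈ K (E₁ \ s₁))
        then (φ (K s₁) - φ (K (E₁ \ s₁))) * (ψ (K s₁) - ψ (K (E₁ \ s₁))) else 0) := by
    intro φ ψ hφ hψ
    have := h₁' X (insert u W) φ ψ hφ hψ
    rw [Finset.sum_filter] at this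
    refine le_of_le_of_eq this (Finset.sum_congr rfl fun s₁ _ => if_congr ?_ rfl rfl)
    constructor
    · rintro ⟨hX, hW⟩
      exact ⟨⟨hX, fun w hw => hW w (Set.mem_insert_of_mem u hw)⟩, hW u (Set.mem_insert u W)⟩
    · rintro ⟨⟨hX, hW⟩, hu⟩
      exact ⟨hX, fun w hw => (Set.mem_insert_iff.mp hw).elim (fun hwu => hwu ▸ hu) (fun hw' => hW w hw')⟩
  have HuXW : ∀ φ ψ : Set V → ℝ, Monotone φ → Monotone ψ →
      0 ≤ ∑ s₁ ∈ E₁.powerset, (if P₁ s₁ ∧ (u ∉ K s₁ ∧ u ∉ K (E₁ \ s₁))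
        then (φ (K s₁) - φ (K (E₁ \ s₁))) * (ψ (K s₁) - ψ (K (E₁ \ s₁))) else 0) := by
    intro φ ψ hφ hψ
    have := h₁' (insert u X) W φ ψ hφ hψ
    rw [Finset.sum_filter] at this
    refine le_of_le_of_eq this (Finset.sum_congr rfl fun s₁ _ => if_congr ?_ rfl rfl)
    constructor
    · rintro ⟨hX, hW⟩
      exact ⟨⟨fun v hv => hX v (Set.mem_insert_of_mem u hv), hW⟩, hX u (Set.mem_insert u X)⟩
    · rintro ⟨⟨hX, hW⟩, hu⟩
      exact ⟨fun v hv => (Set.mem_insert_iff.mp hv).elim (fun hvu => hvu ▸ hu) (fun hv' => hX v hv'), hW⟩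
  have fmono : ∀ B : Set V, Monotone (fun A : Set V => f (gl A B)) := fun B A A' h => hf (gl_mono_left B h)
  have gmono : ∀ B : Set V, Monotone (fun A : Set V => g (gl A B)) := fun B A A' h => hg (gl_mono_left B h)
  have fmonoR : ∀ A : Set V, Monotone (fun B : Set V => f (gl A B)) := fun A B B' h => hf (gl_mono_right A h)
  have gmonoR : ∀ A : Set V, Monotone (fun B : Set V => g (gl A B)) := fun A B B' h => hg (gl_mono_right A h)
  -- CLASS (¬a, ¬b): only the type 'u outside both clusters' is admissible; `J s₂` alone is an NCA sum of `(E₁; X ∪ {u}, W)`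
  have classD : ∀ s₂ : Finset ι, s₂ ⊆ E₂ → ¬ a s₂ → ¬ a (E₂ \ s₂) → 0 ≤ J s₂ := by
    intro s₂ hs₂ hna hnb
    have e : J s₂ = ∑ s₁ ∈ E₁.powerset, (if P₁ s₁ ∧ (u ∉ K s₁ ∧ u ∉ K (E₁ \ s₁))
        then (f (K s₁) - f (K (E₁ \ s₁))) * (g (K s₁) - g (K (E₁ \ s₁))) else 0) := by
      simp only [hJ]
      refine Finset.sum_congr rfl fun s₁ _ => ?_
      by_cases hc : P₁ s₁ ∧ (u ∉ K s₁ ∧ u ∉ K (E₁ \ s₁))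
      · have hc' : P₁ s₁ ∧ (u ∈ K s₁ → a s₂) ∧ (u ∈ K (E₁ \ s₁) → a (E₂ \ s₂)) ∧ (u ∈ K s₁ ∧ u ∈ K (E₁ \ s₁) → z s₂) :=
          ⟨hc.1, fun h => absurd h hc.2.1, fun h => absurd h hc.2.2, fun h => absurd h.1 hc.2.1⟩
        rw [if_pos hc', if_pos hc, gl_of_not _ _ hc.2.1, gl_of_not _ _ hc.2.2]
      · have hc' : ¬ (P₁ s₁ ∧ (u ∈ K s₁ → a s₂) ∧ (u ∈ K (E₁ \ s₁) → a (E₂ \ s₂)) ∧ (u ∈ K s₁ ∧ u ∈ K (E₁ \ s₁) → z s₂)) :=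
          fun h => hc ⟨h.1, fun hu => hna (h.2.1 hu), fun hu => hnb (h.2.2.1 hu)⟩
        rw [if_neg hc', if_neg hc]
    rw [e]
    exact HuXW f g hf hg
  -- CLASS (a, ¬b) paired with its complement: `J s₂ + J (E₂∖s₂) = NCA(E₁; X, W∪{u}) + NCA(E₁; X∪{u}, W)` for the glued pair `(f_{K₂}, g_{K₂})`
  have classB : ∀ s₂ : Finset ι, s₂ ⊆ E₂ → a s₂ → ¬ a (E₂ \ s₂) → 0 ≤ J s₂ + J (E₂ \ s₂) := by
    intro s₂ hs₂ hya hnb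
    have hss : E₂ \ (E₂ \ s₂) = s₂ := Finset.sdiff_sdiff_eq_self hs₂
    set φ : Set V → ℝ := fun A => f (gl A (Ku s₂)) with hφ
    set ψ : Set V → ℝ := fun A => g (gl A (Ku s₂)) with hψ
    have e : J s₂ + J (E₂ \ s₂) =
        ∑ s₁ ∈ E₁.powerset, (if P₁ s₁ ∧ ¬ (u ∈ K s₁ ∧ u ∈ K (E₁ \ s₁))
          then (φ (K s₁) - φ (K (E₁ \ s₁))) * (ψ (K s₁) - ψ (K (E₁ \ s₁))) else 0)
        + ∑ s₁ ∈ E₁.powerset, (if P₁ s₁ ∧ (u ∉ K s₁ ∧ u ∉ K (E₁ \ s₁))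
          then (φ (K s₁) - φ (K (E₁ \ s₁))) * (ψ (K s₁) - ψ (K (E₁ \ s₁))) else 0) := by
      simp only [hJ, hss]
      rw [← Finset.sum_add_distrib, ← Finset.sum_add_distrib]
      refine Finset.sum_congr rfl fun s₁ _ => ?_
      by_cases hp : P₁ s₁
      · by_cases h1 : u ∈ K s₁ <;> by_cases h2 : u ∈ K (E₁ \ s₁)
        · -- `u` in both: nothing admissible on either side
          have c1 : ¬ (P₁ s₁ ∧ (u ∈ K s₁ → a s₂) ∧ (u ∈ K (E₁ \ s₁) → a (E₂ \ s₂)) ∧ (u ∈ K s₁ ∧ u ∈ K (E₁ \ s₁) → z s₂)) := fun h => hnb (h.2.2.1 h2)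
          have c2 : ¬ (P₁ s₁ ∧ (u ∈ K s₁ → a (E₂ \ s₂)) ∧ (u ∈ K (E₁ \ s₁) → a s₂) ∧ (u ∈ K s₁ ∧ u ∈ K (E₁ \ s₁) → z (E₂ \ s₂))) := fun h => hnb (h.2.1 h1)
          have c3 : ¬ (P₁ s₁ ∧ ¬ (u ∈ K s₁ ∧ u ∈ K (E₁ \ s₁))) := fun h => h.2 ⟨h1, h2⟩
          have c4 : ¬ (P₁ s₁ ∧ (u ∉ K s₁ ∧ u ∉ K (E₁ \ s₁))) := fun h => h.2.1 h1
          rw [if_neg c1, if_neg c2, if_neg c3, if_neg c4]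
        · -- `u ∈ K s₁` only: admissible for `s₂`, not for `E₂ ∖ s₂`
          have c1 : (P₁ s₁ ∧ (u ∈ K s₁ → a s₂) ∧ (u ∈ K (E₁ \ s₁) → a (E₂ \ s₂)) ∧ (u ∈ K s₁ ∧ u ∈ K (E₁ \ s₁) → z s₂)) := ⟨hp, fun _ => hya, fun h => absurd h h2, fun h => absurd h.2 h2⟩
          have c2 : ¬ (P₁ s₁ ∧ (u ∈ K s₁ → a (E₂ \ s₂)) ∧ (u ∈ K (E₁ \ s₁) → a s₂) ∧ (u ∈ K s₁ ∧ u ∈ K (E₁ \ s₁) → z (E₂ \ s₂))) := fun h => hnb (h.2.1 h1)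
          have c3 : (P₁ s₁ ∧ ¬ (u ∈ K s₁ ∧ u ∈ K (E₁ \ s₁))) := ⟨hp, fun h => h2 h.2⟩
          have c4 : ¬ (P₁ s₁ ∧ (u ∉ K s₁ ∧ u ∉ K (E₁ \ s₁))) := fun h => h.2.1 h1
          rw [if_pos c1, if_neg c2, if_pos c3, if_neg c4, gl_of_not _ (Ku (E₂ \ s₂)) h2]
          simp only [hφ, hψ, gl_of_not _ (Ku s₂) h2]
        · -- `u ∈ K (E₁∖s₁)` only: admissible for `E₂ ∖ s₂`, not for `s₂`
          have c1 : ¬ (P₁ s₁ ∧ (u ∈ K s₁ → a s₂) ∧ (u ∈ K (E₁ \ s₁) → a (E₂ \ s₂)) ∧ (u ∈ K s₁ ∧ u ∈ K (E₁ \ s₁) → z s₂)) := fun h => hnb (h.2.2.1 h2)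
          have c2 : (P₁ s₁ ∧ (u ∈ K s₁ → a (E₂ \ s₂)) ∧ (u ∈ K (E₁ \ s₁) → a s₂) ∧ (u ∈ K s₁ ∧ u ∈ K (E₁ \ s₁) → z (E₂ \ s₂))) := ⟨hp, fun h => absurd h h1, fun _ => hya, fun h => absurd h.1 h1⟩
          have c3 : (P₁ s₁ ∧ ¬ (u ∈ K s₁ ∧ u ∈ K (E₁ \ s₁))) := ⟨hp, fun h => h1 h.1⟩
          have c4 : ¬ (P₁ s₁ ∧ (u ∉ K s₁ ∧ u ∉ K (E₁ \ s₁))) := fun h => h.2.2 h2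
          rw [if_neg c1, if_pos c2, if_pos c3, if_neg c4, gl_of_not _ (Ku (E₂ \ s₂)) h1]
          simp only [hφ, hψ, gl_of_not _ (Ku s₂) h1]
          ring
        · -- `u` in neither
          have c1 : (P₁ s₁ ∧ (u ∈ K s₁ → a s₂) ∧ (u ∈ K (E₁ \ s₁) → a (E₂ \ s₂)) ∧ (u ∈ K s₁ ∧ u ∈ K (E₁ \ s₁) → z s₂)) := ⟨hp, fun h => absurd h h1, fun h => absurd h h2, fun h => absurd h.1 h1⟩
          have c2 : (P₁ s₁ ∧ (u ∈ K s₁ → a (E₂ \ s₂)) ∧ (u ∈ K (E₁ \ s₁) → a s₂) ∧ (u ∈ K s₁ ∧ u ∈ K (E₁ \ s₁) → z (E₂ \ s₂))) := ⟨hp, fun h => absurd h h1, fun h => absurd h h2, fun h => absurd h.1 h1⟩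
          have c3 : (P₁ s₁ ∧ ¬ (u ∈ K s₁ ∧ u ∈ K (E₁ \ s₁))) := ⟨hp, fun h => h1 h.1⟩
          have c4 : (P₁ s₁ ∧ (u ∉ K s₁ ∧ u ∉ K (E₁ \ s₁))) := ⟨hp, h1, h2⟩
          rw [if_pos c1, if_pos c2, if_pos c3, if_pos c4, gl_of_not _ (Ku s₂) h1, gl_of_not _ (Ku (E₂ \ s₂)) h1,
            gl_of_not _ (Ku s₂) h2, gl_of_not _ (Ku (E₂ \ s₂)) h2]
          simp only [hφ, hψ, gl_of_not _ (Ku s₂) h1, gl_of_not _ (Ku s₂) h2]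
      · have c1 : ¬ (P₁ s₁ ∧ (u ∈ K s₁ → a s₂) ∧ (u ∈ K (E₁ \ s₁) → a (E₂ \ s₂)) ∧ (u ∈ K s₁ ∧ u ∈ K (E₁ \ s₁) → z s₂)) := fun h => hp h.1
        have c2 : ¬ (P₁ s₁ ∧ (u ∈ K s₁ → a (E₂ \ s₂)) ∧ (u ∈ K (E₁ \ s₁) → a s₂) ∧ (u ∈ K s₁ ∧ u ∈ K (E₁ \ s₁) → z (E₂ \ s₂))) := fun h => hp h.1
        have c3 : ¬ (P₁ s₁ ∧ ¬ (u ∈ K s₁ ∧ u ∈ K (E₁ \ s₁))) := fun h => hp h.1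
        have c4 : ¬ (P₁ s₁ ∧ (u ∉ K s₁ ∧ u ∉ K (E₁ \ s₁))) := fun h => hp h.1
        rw [if_neg c1, if_neg c2, if_neg c3, if_neg c4]
    rw [e]
    exact add_nonneg (HXuW φ ψ (fmono _) (gmono _)) (HuXW φ ψ (fmono _) (gmono _))
  -- CLASS (a, b, ¬z): all types but the core are admissible; `J s₂ + J (E₂∖s₂) = NCA(E₁; X, W∪{u})` for the two glued pairs
  have classE : ∀ s₂ : Finset ι, s₂ ⊆ E₂ → a s₂ → a (E₂ \ s₂) → ¬ z s₂ → 0 ≤ J s₂ + J (E₂ \ s₂) := by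
    intro s₂ hs₂ hya hyb hnz
    have hss : E₂ \ (E₂ \ s₂) = s₂ := Finset.sdiff_sdiff_eq_self hs₂
    have hnz' : ¬ z (E₂ \ s₂) := fun h => hnz ((hzc s₂ hs₂).mp h)
    set φ₁ : Set V → ℝ := fun A => f (gl A (Ku s₂)) with hφ₁
    set ψ₁ : Set V → ℝ := fun A => g (gl A (Ku s₂)) with hψ₁
    set φ₂ : Set V → ℝ := fun A => f (gl A (Ku (E₂ \ s₂))) with hφ₂
    set ψ₂ : Set V → ℝ := fun A => g (gl A (Ku (E₂ \ s₂))) with hψ₂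
    have e : J s₂ + J (E₂ \ s₂) =
        ∑ s₁ ∈ E₁.powerset, (if P₁ s₁ ∧ ¬ (u ∈ K s₁ ∧ u ∈ K (E₁ \ s₁))
          then (φ₁ (K s₁) - φ₁ (K (E₁ \ s₁))) * (ψ₁ (K s₁) - ψ₁ (K (E₁ \ s₁))) else 0)
        + ∑ s₁ ∈ E₁.powerset, (if P₁ s₁ ∧ ¬ (u ∈ K s₁ ∧ u ∈ K (E₁ \ s₁))
          then (φ₂ (K s₁) - φ₂ (K (E₁ \ s₁))) * (ψ₂ (K s₁) - ψ₂ (K (E₁ \ s₁))) else 0) := by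
      simp only [hJ, hss]
      rw [← Finset.sum_add_distrib, ← Finset.sum_add_distrib]
      refine Finset.sum_congr rfl fun s₁ _ => ?_
      by_cases hc : P₁ s₁ ∧ ¬ (u ∈ K s₁ ∧ u ∈ K (E₁ \ s₁))
      · have hp := hc.1
        have c1 : (P₁ s₁ ∧ (u ∈ K s₁ → a s₂) ∧ (u ∈ K (E₁ \ s₁) → a (E₂ \ s₂)) ∧ (u ∈ K s₁ ∧ u ∈ K (E₁ \ s₁) → z s₂)) := ⟨hp, fun _ => hya, fun _ => hyb, fun h => absurd h hc.2⟩
        have c2 : (P₁ s₁ ∧ (u ∈ K s₁ → a (E₂ \ s₂)) ∧ (u ∈ K (E₁ \ s₁) → a s₂) ∧ (u ∈ K s₁ ∧ u ∈ K (E₁ \ s₁) → z (E₂ \ s₂))) := ⟨hp, fun _ => hyb, fun _ => hya, fun h => absurd h hc.2⟩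
        rw [if_pos c1, if_pos c2, if_pos hc, if_pos hc]
        by_cases h1 : u ∈ K s₁
        · have h2 : u ∉ K (E₁ \ s₁) := fun h2 => hc.2 ⟨h1, h2⟩
          rw [gl_of_not _ (Ku (E₂ \ s₂)) h2, gl_of_not _ (Ku s₂) h2]
          simp only [hφ₁, hψ₁, hφ₂, hψ₂, gl_of_not _ (Ku s₂) h2, gl_of_not _ (Ku (E₂ \ s₂)) h2]
        · rw [gl_of_not _ (Ku s₂) h1, gl_of_not _ (Ku (E₂ \ s₂)) h1]
          simp only [hφ₁, hψ₁, hφ₂, hψ₂, gl_of_not _ (Ku s₂) h1, gl_of_not _ (Ku (E₂ \ s₂)) h1]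
          ring
      · have c1 : ¬ (P₁ s₁ ∧ (u ∈ K s₁ → a s₂) ∧ (u ∈ K (E₁ \ s₁) → a (E₂ \ s₂)) ∧ (u ∈ K s₁ ∧ u ∈ K (E₁ \ s₁) → z s₂)) := fun h => hc ⟨h.1, fun hu => hnz (h.2.2.2 hu)⟩
        have c2 : ¬ (P₁ s₁ ∧ (u ∈ K s₁ → a (E₂ \ s₂)) ∧ (u ∈ K (E₁ \ s₁) → a s₂) ∧ (u ∈ K s₁ ∧ u ∈ K (E₁ \ s₁) → z (E₂ \ s₂))) := fun h => hc ⟨h.1, fun hu => hnz' (h.2.2.2 hu)⟩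
        rw [if_neg c1, if_neg c2, if_neg hc, if_neg hc]
    rw [e]
    exact add_nonneg (HXuW φ₁ ψ₁ (fmono _) (gmono _)) (HXuW φ₂ ψ₂ (fmono _) (gmono _))
  -- CLASS (a, b, z) = the NCA event of `(E₂, u)`: the decoration identity, with residual `RES s₂`
  set RES : Finset ι → ℝ := fun s₂ => ∑ s₁ ∈ E₁.powerset, (if P₁ s₁ then
      (f (gl (K s₁) (Ku s₂)) - f (gl (K s₁) (Ku (E₂ \ s₂)))) * (g (gl (K s₁) (Ku s₂)) - g (gl (K s₁) (Ku (E₂ \ s₂)))) +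
      (f (gl (K (E₁ \ s₁)) (Ku s₂)) - f (gl (K (E₁ \ s₁)) (Ku (E₂ \ s₂)))) * (g (gl (K (E₁ \ s₁)) (Ku s₂)) - g (gl (K (E₁ \ s₁)) (Ku (E₂ \ s₂))))
      else 0) with hRES
  have classA : ∀ s₂ : Finset ι, s₂ ⊆ E₂ → a s₂ → a (E₂ \ s₂) → z s₂ → RES s₂ ≤ J s₂ + J (E₂ \ s₂) := by
    intro s₂ hs₂ hya hyb hyz
    have hss : E₂ \ (E₂ \ s₂) = s₂ := Finset.sdiff_sdiff_eq_self hs₂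
    have hyz' : z (E₂ \ s₂) := (hzc s₂ hs₂).mpr hyz
    set φ₁ : Set V → ℝ := fun A => f (gl A (Ku s₂)) with hφ₁
    set ψ₁ : Set V → ℝ := fun A => g (gl A (Ku s₂)) with hψ₁
    set φ₂ : Set V → ℝ := fun A => f (gl A (Ku (E₂ \ s₂))) with hφ₂
    set ψ₂ : Set V → ℝ := fun A => g (gl A (Ku (E₂ \ s₂))) with hψ₂
    have e : J s₂ + J (E₂ \ s₂) =
        ∑ s₁ ∈ E₁.powerset, (if P₁ s₁ then (φ₁ (K s₁) - φ₁ (K (E₁ \ s₁))) * (ψ₂ (K s₁) - ψ₂ (K (E₁ \ s₁))) else 0)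
        + ∑ s₁ ∈ E₁.powerset, (if P₁ s₁ then (φ₂ (K s₁) - φ₂ (K (E₁ \ s₁))) * (ψ₁ (K s₁) - ψ₁ (K (E₁ \ s₁))) else 0)
        + RES s₂ := by
      simp only [hJ, hRES, hss]
      rw [← Finset.sum_add_distrib, ← Finset.sum_add_distrib, ← Finset.sum_add_distrib]
      refine Finset.sum_congr rfl fun s₁ _ => ?_
      by_cases hp : P₁ s₁
      · have c1 : (P₁ s₁ ∧ (u ∈ K s₁ → a s₂) ∧ (u ∈ K (E₁ \ s₁) → a (E₂ \ s₂)) ∧ (u ∈ K s₁ ∧ u ∈ K (E₁ \ s₁) → z s₂)) := ⟨hp, fun _ => hya, fun _ => hyb, fun _ => hyz⟩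
        have c2 : (P₁ s₁ ∧ (u ∈ K s₁ → a (E₂ \ s₂)) ∧ (u ∈ K (E₁ \ s₁) → a s₂) ∧ (u ∈ K s₁ ∧ u ∈ K (E₁ \ s₁) → z (E₂ \ s₂))) := ⟨hp, fun _ => hyb, fun _ => hya, fun _ => hyz'⟩
        rw [if_pos c1, if_pos c2, if_pos hp, if_pos hp, if_pos hp]
        simp only [hφ₁, hψ₁, hφ₂, hψ₂]
        ring
      · have c1 : ¬ (P₁ s₁ ∧ (u ∈ K s₁ → a s₂) ∧ (u ∈ K (E₁ \ s₁) → a (E₂ \ s₂)) ∧ (u ∈ K s₁ ∧ u ∈ K (E₁ \ s₁) → z s₂)) := fun h => hp h.1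
        have c2 : ¬ (P₁ s₁ ∧ (u ∈ K s₁ → a (E₂ \ s₂)) ∧ (u ∈ K (E₁ \ s₁) → a s₂) ∧ (u ∈ K s₁ ∧ u ∈ K (E₁ \ s₁) → z (E₂ \ s₂))) := fun h => hp h.1
        rw [if_neg c1, if_neg c2, if_neg hp, if_neg hp, if_neg hp]
        ring
    rw [e]
    have hA1 := HXW φ₁ ψ₂ (fmono _) (gmono _)
    have hA2 := HXW φ₂ ψ₁ (fmono _) (gmono _)
    linarith
  -- the residuals, summed over the class, are NCA sums of `(E₂, u)` for the shifted pairs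
  set C₂ : Finset ι → Prop := fun s => (∀ v ∈ X, v ∉ Ku s ∧ v ∉ Ku (E₂ \ s)) ∧ (∀ w ∈ W, ¬ (w ∈ Ku s ∧ w ∈ Ku (E₂ \ s))) with hC₂
  have hC₂_iff : ∀ s₂ : Finset ι, C₂ s₂ ↔ (a s₂ ∧ a (E₂ \ s₂) ∧ z s₂) := by
    intro s₂
    constructor
    · rintro ⟨hXX, hWW⟩
      exact ⟨fun v hv => (hXX v hv).1, fun v hv => (hXX v hv).2, hWW⟩
    · rintro ⟨h1, h2, h3⟩
      exact ⟨fun v hv => ⟨h1 v hv, h2 v hv⟩, h3⟩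
  have pair : ∀ s₂ ∈ E₂.powerset, (if C₂ s₂ then RES s₂ else 0) ≤ J s₂ + J (E₂ \ s₂) := by
    intro s₂ hs₂
    have hs₂' := Finset.mem_powerset.mp hs₂
    have hss : E₂ \ (E₂ \ s₂) = s₂ := Finset.sdiff_sdiff_eq_self hs₂'
    by_cases hya : a s₂ <;> by_cases hyb : a (E₂ \ s₂)
    · by_cases hyz : z s₂
      · rw [if_pos ((hC₂_iff s₂).mpr ⟨hya, hyb, hyz⟩)]
        exact classA s₂ hs₂' hya hyb hyz
      · rw [if_neg (fun h => hyz ((hC₂_iff s₂).mp h).2.2)]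
        exact classE s₂ hs₂' hya hyb hyz
    · rw [if_neg (fun h => hyb ((hC₂_iff s₂).mp h).2.1)]
      exact classB s₂ hs₂' hya hyb
    · rw [if_neg (fun h => hya ((hC₂_iff s₂).mp h).1)]
      have hna' : ¬ a (E₂ \ (E₂ \ s₂)) := by rw [hss]; exact hya
      have := classB (E₂ \ s₂) Finset.sdiff_subset hyb hna'
      rw [hss, add_comm] at this
      exact this
    · rw [if_neg (fun h => hya ((hC₂_iff s₂).mp h).1)]
      have hnb' : ¬ a (E₂ \ (E₂ \ s₂)) := by rw [hss]; exact hya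
      exact add_nonneg (classD s₂ hs₂' hya hyb) (classD (E₂ \ s₂) Finset.sdiff_subset hyb hnb')
  have hRESsum : 0 ≤ ∑ s₂ ∈ E₂.powerset, (if C₂ s₂ then RES s₂ else 0) := by
    rw [← Finset.sum_filter]
    have expand : ∑ s₂ ∈ E₂.powerset.filter C₂, RES s₂ =
        ∑ s₁ ∈ E₁.powerset, ∑ s₂ ∈ E₂.powerset.filter C₂, (if P₁ s₁ then
          (f (gl (K s₁) (Ku s₂)) - f (gl (K s₁) (Ku (E₂ \ s₂)))) * (g (gl (K s₁) (Ku s₂)) - g (gl (K s₁) (Ku (E₂ \ s₂)))) +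
          (f (gl (K (E₁ \ s₁)) (Ku s₂)) - f (gl (K (E₁ \ s₁)) (Ku (E₂ \ s₂)))) * (g (gl (K (E₁ \ s₁)) (Ku s₂)) - g (gl (K (E₁ \ s₁)) (Ku (E₂ \ s₂))))
          else 0) := by
      simp only [hRES]
      rw [Finset.sum_comm]
    rw [expand]
    refine Finset.sum_nonneg fun s₁ _ => ?_
    by_cases hp : P₁ s₁
    · simp only [if_pos hp]
      rw [Finset.sum_add_distrib]
      exact add_nonneg (h₂' X W (fun B => f (gl (K s₁) B)) (fun B => g (gl (K s₁) B)) (fmonoR _) (gmonoR _))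
        (h₂' X W (fun B => f (gl (K (E₁ \ s₁)) B)) (fun B => g (gl (K (E₁ \ s₁)) B)) (fmonoR _) (gmonoR _))
    · simp only [if_neg hp, Finset.sum_const_zero]
      exact le_refl _
  -- assembly: `2 · Σ J = Σ (J s₂ + J (E₂∖s₂)) ≥ Σ [C₂] RES ≥ 0`
  have hswap : ∑ s₂ ∈ E₂.powerset, J (E₂ \ s₂) = ∑ s₂ ∈ E₂.powerset, J s₂ := sum_powerset_sdiff E₂ J
  have htwice : 2 * ∑ s₂ ∈ E₂.powerset, J s₂ = ∑ s₂ ∈ E₂.powerset, (J s₂ + J (E₂ \ s₂)) := by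
    rw [two_mul, Finset.sum_add_distrib, hswap]
  have hge : ∑ s₂ ∈ E₂.powerset, (if C₂ s₂ then RES s₂ else 0) ≤ ∑ s₂ ∈ E₂.powerset, (J s₂ + J (E₂ \ s₂)) :=
    Finset.sum_le_sum pair
  linarith
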